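import Summits.QuantumFields.QCD.Theses.NestedDissectionSea
import Literature.MathematicalPhysics.QuantumLattice.WilsonPositivityDomain

/-!
# Crux `EarlyCrosserLaw` (route `NestedDissectionSea`, item stmt-QuantumFields-13995), negative side —
# the Dirichlet-cell positivity domain and the one-site cell

Support file of the standing disprover (cdisprove) of the crux.  Sorry-free, standard axioms; pure
matrix facts about the route's `wilsonCell` (no measure theory).

* § 1 `det_toSquareBlockProp_wilsonDirac_ne_zero` / `wilsonCell_det_ne_zero_of_pos`: at bare mass
  `m > 0` NO principal submatrix of the `r = 1` Wilson–Dirac matrix (no Dirichlet cell of the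
  nested dissection, on any index set, for any gauge field) is singular — from the numerical range
  `Re⟨v, D_W(U,m,1) v⟩ ≥ m‖v‖²` (`re_quadForm_wilsonDirac_ge`), itself from the tree's
  `wilsonDirac_eq_sub_sum_wilsonHop` and `‖W_μ‖ ≤ 1` (the cell-level companion of the torus facts
  `wilsonDirac_det_ne_zero_of_pos`, `fermionDet_wilsonDirac_re_pos`).  Consequence for the crux:
  the cover event of clause (a′) is EMPTY whenever `m_f(k) > 0`.
* § 4 `wilsonCell_two_det_eq_zero_iff`: the one-site Dirichlet cell (sides `(2,2,2,2)`) of ANY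
  gauge field is the scalar `μ + 4`, singular exactly at `μ' = -4` — the only gauge-field-independent
  crossing, which the cover event of (a′) sees only if `m_f(k) ≤ -4`.

Companion file `LowerPinLoadBearing.lean` (same directory) uses § 1 to show that the crux with its
lower pin (b) deleted is a theorem.  Standard material [folklore]; no Theses statement is asserted.
-/

noncomputable section

open Matrix Complex Filter
open Literature.MathematicalPhysics.QuantumLattice Literature.MathematicalPhysics.QuantumFieldTheory
  Literature.Probability.LatticeModels
open Summit.QuantumFields.QCD.Theses.NestedDissectionSea

namespace Summit.QuantumFields.QCD.Theorems.EarlyCrosserLawNegative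

open scoped Matrix.Norms.L2Operator ComplexConjugate

/-! ## § 1  Positivity domain for Dirichlet cells (numerical range of `D_W`) -/

/-- Termwise polarisation bound: `Re(conj a · b) ≤ (‖a‖² + ‖b‖²)/2`. [folklore] -/
theorem re_conj_mul_le (a b : ℂ) : (conj a * b).re ≤ (‖a‖ ^ 2 + ‖b‖ ^ 2) / 2 := by
  rw [Complex.sq_norm, Complex.sq_norm, Complex.normSq_apply, Complex.normSq_apply]
  simp only [Complex.mul_re, Complex.conj_re, Complex.conj_im]
  nlinarith [sq_nonneg (a.re - b.re), sq_nonneg (a.im - b.im)]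

section Torus

variable {L N : ℕ} [NeZero L] {G : Type*} [Group G] (ρ : G →* Matrix (Fin N) (Fin N) ℂ)

/-- For a matrix of `ℓ²` operator norm `≤ 1`: `Re Σ_i conj(v i) (W v)_i ≤ Σ_i ‖v i‖²`. [folklore] -/
theorem re_sum_conj_mul_mulVec_le
    (W : Matrix (TorusSite 4 L × Fin N × Fin 4) (TorusSite 4 L × Fin N × Fin 4) ℂ)
    (hW : ‖W‖ ≤ 1) (v : TorusSite 4 L × Fin N × Fin 4 → ℂ) :
    (∑ i, conj (v i) * (W *ᵥ v) i).re ≤ ∑ i, ‖v i‖ ^ 2 := by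
  have h1 : ∑ i, ‖(W *ᵥ v) i‖ ^ 2 ≤ ∑ i, ‖v i‖ ^ 2 := by
    refine (sum_norm_sq_mulVec_le W v).trans ?_
    have h0 : 0 ≤ ∑ i, ‖v i‖ ^ 2 := Finset.sum_nonneg fun i _ => by positivity
    have : ‖W‖ ^ 2 ≤ 1 := by nlinarith [norm_nonneg W]
    nlinarith
  rw [Complex.re_sum]
  have h2 : ∑ i, (conj (v i) * (W *ᵥ v) i).re ≤ ∑ i, (‖v i‖ ^ 2 + ‖(W *ᵥ v) i‖ ^ 2) / 2 :=
    Finset.sum_le_sum fun i _ => re_conj_mul_le _ _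
  have h3 : ∑ i, (‖v i‖ ^ 2 + ‖(W *ᵥ v) i‖ ^ 2) / 2 =
      ((∑ i, ‖v i‖ ^ 2) + ∑ i, ‖(W *ᵥ v) i‖ ^ 2) / 2 := by
    rw [← Finset.sum_div, Finset.sum_add_distrib]
  linarith

/-- **Numerical range of the Wilson–Dirac operator** (`r = 1`, unitary colour representation, any
periodic four-torus, any gauge field, any real bare mass `m`): `m Σ_i‖v i‖² ≤ Re Σ_i conj(v i)(D_W v)_i`.
The hermitian part of the massless operator is the covariant Wilson Laplacian `½Σ_μ ∇_μ†∇_μ ≥ 0`;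
here from `D_W = (m+4)·1 - Σ_μ W_μ` (`wilsonDirac_eq_sub_sum_wilsonHop`) and `‖W_μ‖ ≤ 1`.
This is the exact layer E2/KineticEdge of the route at its crudest (edge `0` instead of
`Σ(1 - cos(π/s_i))`). [folklore] -/
theorem re_quadForm_wilsonDirac_ge (hρ : ∀ g, ρ g ∈ Matrix.unitaryGroup (Fin N) ℂ)
    (U : GaugeConfig 4 L G) (m : ℝ) (v : TorusSite 4 L × Fin N × Fin 4 → ℂ) :
    m * ∑ i, ‖v i‖ ^ 2 ≤ (∑ i, conj (v i) * (wilsonDirac ρ U m 1 *ᵥ v) i).re := by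
  rw [wilsonDirac_eq_sub_sum_wilsonHop ρ hρ U m, Matrix.sub_mulVec, Matrix.smul_mulVec,
    Matrix.one_mulVec, Matrix.sum_mulVec]
  have hdiag : (∑ i, conj (v i) * ((((m + 4 : ℝ) : ℂ) • v) i)).re = (m + 4) * ∑ i, ‖v i‖ ^ 2 := by
    rw [Complex.re_sum, Finset.mul_sum]
    refine Finset.sum_congr rfl fun i _ => ?_
    rw [Pi.smul_apply, smul_eq_mul, mul_left_comm, Complex.re_ofReal_mul, Complex.conj_mul',
      ← Complex.ofReal_pow, Complex.ofReal_re]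
  have hsum : ∀ μ : Fin 4, (∑ i, conj (v i) * (wilsonHop ρ U μ *ᵥ v) i).re ≤ ∑ i, ‖v i‖ ^ 2 :=
    fun μ => re_sum_conj_mul_mulVec_le (wilsonHop ρ U μ) (l2_opNorm_wilsonHop_le ρ hρ U μ) v
  have hexp : (∑ i, conj (v i) * ((((m + 4 : ℝ) : ℂ) • v) - ∑ μ, wilsonHop ρ U μ *ᵥ v) i) =
      (∑ i, conj (v i) * ((((m + 4 : ℝ) : ℂ) • v) i)) -
        ∑ μ, ∑ i, conj (v i) * (wilsonHop ρ U μ *ᵥ v) i := by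
    rw [Finset.sum_comm, ← Finset.sum_sub_distrib]
    refine Finset.sum_congr rfl fun i _ => ?_
    rw [Pi.sub_apply, Finset.sum_apply, mul_sub, Finset.mul_sum]
  rw [hexp, Complex.sub_re, hdiag, Complex.re_sum]
  have h4 : ∑ μ : Fin 4, (∑ i, conj (v i) * (wilsonHop ρ U μ *ᵥ v) i).re ≤
      ∑ _μ : Fin 4, ∑ i, ‖v i‖ ^ 2 := Finset.sum_le_sum fun μ _ => hsum μ
  have h4' : ∑ _μ : Fin 4, ∑ i, ‖v i‖ ^ 2 = 4 * ∑ i, ‖v i‖ ^ 2 := by simp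
  linarith

/-- **Positivity domain for Dirichlet cells.** At bare mass `m > 0` no principal submatrix of the
Wilson–Dirac matrix (no Dirichlet cell, on ANY index set — boxes, children, separators) is singular,
for every gauge field: a kernel vector, extended by zero, would have `Re⟨v, D_W v⟩ = 0 ≥ m‖v‖² > 0`.
Instance-polymorphic in the `Fintype`/`DecidableEq` structure of the subtype so that it applies to
the route's `wilsonCell` verbatim (which is `toSquareBlockProp … (wilsonBox x s)` by definition).
Consequence for the crux: the cover event of (a′) is EMPTY as soon as `m_f(k) > 0`. [folklore] -/
theorem det_toSquareBlockProp_wilsonDirac_ne_zero (hρ : ∀ g, ρ g ∈ Matrix.unitaryGroup (Fin N) ℂ)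
    (U : GaugeConfig 4 L G) {m : ℝ} (hm : 0 < m) (p : TorusSite 4 L × Fin N × Fin 4 → Prop)
    [Fintype {a // p a}] [DecidableEq {a // p a}] :
    (Matrix.toSquareBlockProp (wilsonDirac ρ U m 1) p).det ≠ 0 := by
  classical
  intro hdet
  obtain ⟨w, hw0, hw⟩ := Matrix.exists_mulVec_eq_zero_iff.mpr hdet
  set v : TorusSite 4 L × Fin N × Fin 4 → ℂ := fun i => if h : p i then w ⟨i, h⟩ else 0 with hv
  have hvp : ∀ i : {a // p a}, v i = w i := fun i => by simp [hv, i.2]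
  have hvn : ∀ i, ¬ p i → v i = 0 := fun i hi => by simp [hv, hi]
  have hDv : ∀ i : {a // p a}, (wilsonDirac ρ U m 1 *ᵥ v) i =
      (Matrix.toSquareBlockProp (wilsonDirac ρ U m 1) p *ᵥ w) i := by
    intro i
    simp only [Matrix.mulVec, dotProduct, Matrix.toSquareBlockProp_def, Matrix.of_apply]
    have hR : (∑ j : {a // p a}, wilsonDirac ρ U m 1 (i : TorusSite 4 L × Fin N × Fin 4) j * w j) =
        ∑ j ∈ Finset.univ.filter p,
          wilsonDirac ρ U m 1 (i : TorusSite 4 L × Fin N × Fin 4) j * v j := by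
      rw [Finset.sum_subtype (Finset.univ.filter p) (p := p) (fun j => by simp)]
      exact Finset.sum_congr rfl fun j _ => by rw [hvp j]
    rw [hR, Finset.sum_filter]
    refine Finset.sum_congr rfl fun j _ => ?_
    by_cases hj : p j
    · simp [hj]
    · simp [hj, hvn j hj]
  have hquad : (∑ i, conj (v i) * (wilsonDirac ρ U m 1 *ᵥ v) i) = 0 := by
    have : ∀ i, conj (v i) * (wilsonDirac ρ U m 1 *ᵥ v) i =
        if h : p i then conj (w ⟨i, h⟩) *
          (Matrix.toSquareBlockProp (wilsonDirac ρ U m 1) p *ᵥ w) ⟨i, h⟩ else 0 := by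
      intro i
      by_cases hi : p i
      · rw [dif_pos hi, ← hDv ⟨i, hi⟩, hvp ⟨i, hi⟩]
      · rw [dif_neg hi, hvn i hi, map_zero, zero_mul]
    simp_rw [this, hw, Pi.zero_apply, mul_zero, dite_eq_ite, ite_self, Finset.sum_const_zero]
  have hS : 0 < ∑ i, ‖v i‖ ^ 2 := by
    obtain ⟨i, hi⟩ : ∃ i, w i ≠ 0 := by
      by_contra h
      push Not at h
      exact hw0 (funext h)
    have hpos : 0 < ‖v i‖ ^ 2 := by rw [hvp i]; positivity
    have hle : ‖v i‖ ^ 2 ≤ ∑ j, ‖v j‖ ^ 2 :=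
      Finset.single_le_sum (f := fun j => ‖v j‖ ^ 2) (fun j _ => by positivity)
        (Finset.mem_univ (i : TorusSite 4 L × Fin N × Fin 4))
    exact lt_of_lt_of_le hpos hle
  have := re_quadForm_wilsonDirac_ge ρ hρ U m v
  rw [hquad, Complex.zero_re] at this
  nlinarith

end Torus

/-- **No Dirichlet cell of the SU(3) theory is singular at positive bare mass** (the route's
`wilsonCell`, any corner, any sides, any torus). [folklore] -/
theorem wilsonCell_det_ne_zero_of_pos {N : ℕ} [NeZero N] (U : GaugeConfig 4 N (Matrix.specialUnitaryGroup (Fin 3) ℂ)) {μ : ℝ}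
    (hμ : 0 < μ) (x : TorusSite 4 N) (s : Fin 4 → ℕ) : (wilsonCell U μ x s).det ≠ 0 :=
  det_toSquareBlockProp_wilsonDirac_ne_zero (fundamentalRep (Fin 3)) fundamentalRep_mem_unitaryGroup
    U hμ (wilsonBox x s)

/-! ## § 4  Tightness: the only gauge-field-independent crossing is `μ' = -4` (one-site cells) -/

section OneSite

variable {N : ℕ} [NeZero N]


/-- In a box with all sides `2` the site of every index is the corner shifted by `(1,1,1,1)`. -/
theorem site_eq_of_wilsonBox_two (hN : 2 ≤ N) (x : TorusSite 4 N)
    (p : TorusSite 4 N × Fin 3 × Fin 4) (hp : wilsonBox x (fun _ => 2) p) :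
    p.1 = fun i => x i + 1 := by
  funext i
  obtain ⟨h0, h2⟩ := hp i
  have h2' : (p.1 i - x i).val < 2 := h2
  have h1 : (p.1 i - x i).val = 1 := by omega
  have hval : (p.1 i - x i).val = (1 : ZMod N).val := by
    rw [h1, ZMod.val_one'' (by omega)]
  have := ZMod.val_injective N hval
  rw [sub_eq_iff_eq_add'] at this
  rw [this]

/-- No Wilson hop stays inside a one-site box (`N ≥ 2`). -/
theorem not_shift_of_wilsonBox_two (hN : 2 ≤ N) (x : TorusSite 4 N)
    (p q : TorusSite 4 N × Fin 3 × Fin 4) (hp : wilsonBox x (fun _ => 2) p)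
    (hq : wilsonBox x (fun _ => 2) q) (μ : Fin 4) : q.1 ≠ Literature.MathematicalPhysics.QuantumFieldTheory.Site.shift p.1 μ := by
  intro h
  have hp' := site_eq_of_wilsonBox_two hN x p hp
  have hq' := site_eq_of_wilsonBox_two hN x q hq
  rw [Literature.MathematicalPhysics.QuantumFieldTheory.Site.shift, hp', hq'] at h
  have h' := congr_fun h μ
  simp only [Pi.add_apply, Pi.single_eq_same] at h'
  have h1 : (1 : ZMod N) = 0 := by
    have := h'
    -- x μ + 1 = x μ + 1 + 1
    have : x μ + 1 + 1 = x μ + 1 + 0 := by rw [add_zero]; exact this.symm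
    exact add_left_cancel this
  rw [ZMod.one_eq_zero_iff] at h1
  omega

/-- **The one-site Dirichlet cell is the scalar `μ + 4`**: for sides `(2,2,2,2)` the cell matrix of
ANY gauge field is `(μ+4)·1` (no hop stays inside). -/
theorem wilsonCell_two_eq_smul_one (hN : 2 ≤ N) (U : GaugeConfig 4 N (Matrix.specialUnitaryGroup (Fin 3) ℂ)) (μ : ℝ) (x : TorusSite 4 N) :
    wilsonCell U μ x (fun _ => 2) = ((μ + 4 : ℝ) : ℂ) • (1 : Matrix _ _ ℂ) := by
  ext p q
  have hp := p.2
  have hq := q.2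
  have hnf : ∀ ν : Fin 4, ¬ ((q : TorusSite 4 N × Fin 3 × Fin 4).1 = Literature.MathematicalPhysics.QuantumFieldTheory.Site.shift (p : TorusSite 4 N × Fin 3 × Fin 4).1 ν) :=
    fun ν => not_shift_of_wilsonBox_two hN x p q hp hq ν
  have hnb : ∀ ν : Fin 4, ¬ ((p : TorusSite 4 N × Fin 3 × Fin 4).1 = Literature.MathematicalPhysics.QuantumFieldTheory.Site.shift (q : TorusSite 4 N × Fin 3 × Fin 4).1 ν) :=
    fun ν => not_shift_of_wilsonBox_two hN x q p hq hp ν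
  simp only [wilsonCell, Matrix.toSquareBlockProp_def, Matrix.of_apply, wilsonDirac, hnf, hnb,
    if_false, add_zero, Finset.sum_const_zero, mul_zero, sub_zero, Matrix.smul_apply,
    Matrix.one_apply, smul_eq_mul, mul_ite, mul_one, Subtype.ext_iff]

/-- Its determinant is `(μ+4)^{#cell}`. -/
theorem det_wilsonCell_two (hN : 2 ≤ N) (U : GaugeConfig 4 N (Matrix.specialUnitaryGroup (Fin 3) ℂ)) (μ : ℝ) (x : TorusSite 4 N) :
    (wilsonCell U μ x (fun _ => 2)).det =
      ((μ + 4 : ℝ) : ℂ) ^ Fintype.card {p // wilsonBox x (fun _ => (2 : ℕ)) p} := by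
  rw [wilsonCell_two_eq_smul_one hN U μ x, det_smul, det_one, mul_one]

/-- The one-site box is non-empty (`N ≥ 2`). -/
theorem card_wilsonBox_two_pos (hN : 2 ≤ N) (x : TorusSite 4 N) :
    0 < Fintype.card {p // wilsonBox x (fun _ => (2 : ℕ)) p} := by
  refine Fintype.card_pos_iff.mpr ⟨⟨((fun i => x i + 1), 0, 0), fun i => ?_⟩⟩
  simp only [add_sub_cancel_left, ZMod.val_one'' (show N ≠ 1 by omega)]
  omega

/-- **The only gauge-field-independent crossing: `μ' = −4`.**  For every SU(3) field on every torus
of side `N ≥ 2`, the one-site Dirichlet cell (sides `(2,2,2,2)`, the `j = 0` window box when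
`b₀ = 2`, and a child of the window boxes of sides `≤ 5`) is singular EXACTLY at bare mass `-4`.
Tightness reading: the restriction `μ' ≥ m_f(k)` in the cover event of (a′) is what keeps (a′) from
being refuted by a certain event (through `P(univ) = 1` or the den = 0 dichotomy) — it would bite
only for `m_f(k) ≤ -4`, excluded by the lower pin near the honest line. -/
theorem wilsonCell_two_det_eq_zero_iff (hN : 2 ≤ N) (U : GaugeConfig 4 N (Matrix.specialUnitaryGroup (Fin 3) ℂ)) (μ : ℝ)
    (x : TorusSite 4 N) : (wilsonCell U μ x (fun _ => 2)).det = 0 ↔ μ = -4 := by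
  rw [det_wilsonCell_two hN, pow_eq_zero_iff (card_wilsonBox_two_pos hN x).ne', Complex.ofReal_eq_zero]
  constructor <;> intro h <;> linarith

end OneSite

end Summit.QuantumFields.QCD.Theorems.EarlyCrosserLawNegative

end
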